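import Mathlib.Analysis.Convex.Contractible
import Literature.AlgebraicGeometry.HodgeTheory.AffineLineBundleCohomology
import HarnessLib

/-!
# Affine-space bundles are cohomology isomorphisms on complex points

Family `hodge`, layer `Literature/AlgebraicGeometry/HodgeTheory`; companion to
`AffineLineBundleCohomology` (the case of the affine line over a literal open subscheme). For a
`ℂ`-morphism `π : Y ⟶ X` which is, Zariski-locally on `X`, the first projection `V × 𝔸ʳ → V` — the
shape of a torsor under a vector bundle of rank `r`, e.g. Jouanolou's affine `W → X` over a
quasi-projective `X` (Jouanolou 1973, Lemme 1.5), or the complement of the section at infinity in a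
completed line bundle — the pull-back `π^* : Hᵏ(X(ℂ); ℂ) → Hᵏ(Y(ℂ); ℂ)` is bijective for every `k`
as soon as `X(ℂ)` is paracompact Hausdorff (Dold 1963, Thm. 6.3: such a bundle is a homotopy
equivalence; here via the tree's Leray–Hirsch theorem with the single class `1`,
`bijective_map_of_trivial_contractible_fibre`, Husemoller Ch. 17 §1 Thm. 1.1).

* `IsZariskiLocallyAffineProduct π r` (§1) — the Zariski-local product structure, stated through
  open immersions `j : V ⟶ X`, `i : W ⟶ Y` and isomorphisms `W ≅ V ⊗ 𝔸ʳ` with `e ≫ pr₁ ≫ j = i ≫ π`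
  (a formulation by immersions rather than literal open subschemes, so that it is visibly stable
  under isomorphisms and base change);
* `exists_trivialisation_of_chart` (§2, PROVED) — one algebraic chart gives a topological
  trivialisation of `π(ℂ)` over the open subset `{Q | pt Q ∈ j(V)}` of `X(ℂ)` with fibre `ℂʳ`
  (complex points commute with open immersions, products and `𝔸ʳ(ℂ) = ℂʳ`:
  `AlgPoints.isOpenEmbedding_map_holds`, `AlgPoints.prodEquiv`, `ComplexPoints.affineHomeomorph`);
* `bijective_complexBetti_map_of_isZariskiLocallyAffineProduct` (§2, PROVED) — the statement above.

This is the topological half of the named fact `jouanolou_cohomologyChart` of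
`ConjugationChartExistence` (input (J) of the existence of conjugation charts / conjugate classes);
the algebraic half is Jouanolou's lemma itself. Theorem-only apart from the definition of §1; no
named facts.

## References

* J.-P. Jouanolou, *Une suite exacte de Mayer–Vietoris en K-théorie algébrique*, LNM 341 (1973), Lemme 1.5.
* A. Dold, *Partitions of unity in the theory of fibrations*, Ann. of Math. 78 (1963), Thm. 6.3.
* D. Husemoller, *Fibre Bundles*, 3rd ed., GTM 20 (1994), Ch. 17 §1 Thm. 1.1.
* J.-P. Serre, *GAGA*, Ann. Inst. Fourier 6 (1956), §2 n°5.
-/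

noncomputable section

open CategoryTheory AlgebraicGeometry Function Set MonoidalCategory
open Literature.NumberTheory.Transcendental
open Literature.AlgebraicTopology.SingularHomology
open Literature.AlgebraicGeometry.Motives

namespace Literature.AlgebraicGeometry.HodgeTheory

section HodgeTheory

/-! ### §1 Zariski-local products with affine space -/

/-- A `ℂ`-morphism `π : Y ⟶ X` is **Zariski-locally on `X` a product with affine `r`-space**: every
point of `X` lies in the image of an open immersion `j : V ⟶ X` over `ℂ` for which there are an open
immersion `i : W ⟶ Y` onto (at least) `π⁻¹(j(V))` and an isomorphism `W ≅ V ×_ℂ 𝔸ʳ_ℂ` of `ℂ`-schemes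
turning `π` into the first projection (`e ≫ pr₁ ≫ j = i ≫ π`). A torsor under a vector bundle of rank
`r` (Jouanolou's `W → X`) is of this form: such torsors are Zariski-locally trivial.
[cite: Jouanolou1973, Lemme 1.5] -/
def IsZariskiLocallyAffineProduct {Y X : SchemeOver ℂ} (π : Y ⟶ X) (r : ℕ) : Prop :=
  ∀ x : X.left, ∃ (V W : SchemeOver ℂ) (j : V ⟶ X) (i : W ⟶ Y) (_ : IsOpenImmersion j.left)
    (_ : IsOpenImmersion i.left) (e : W ≅ V ⊗ affineSpaceOver (Fin r) ℂ),
    x ∈ Set.range j.left.base ∧ π.left.base ⁻¹' Set.range j.left.base ⊆ Set.range i.left.base ∧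
      e.hom ≫ CartesianMonoidalCategory.fst _ _ ≫ j = i ≫ π

/-! ### §2 Affine-space bundles induce isomorphisms on complex cohomology -/

section Topology

variable {Y X : SchemeOver ℂ}

/-- The complex points of the source of an open immersion `j : V ⟶ X` over `ℂ`, as the open subspace
`{Q | pt Q ∈ j(V)}` of `X(ℂ)`: a homeomorphism over `j(ℂ)` (`AlgPoints.isOpenEmbedding_map_holds`,
`AlgPoints.range_map_of_isOpenImmersion_holds`). [cite: SerreGAGA1956, §2 n°5] -/
theorem exists_homeomorph_of_isOpenImmersion {V : SchemeOver ℂ} (j : V ⟶ X) [IsOpenImmersion j.left] :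
    ∃ θ : ComplexPoints V ≃ₜ ↥{Q : ComplexPoints X | Q.pt ∈ Set.range j.left.base},
      ∀ P, ((θ P : ↥{Q : ComplexPoints X | Q.pt ∈ Set.range j.left.base}) : ComplexPoints X) =
        AlgPoints.map j P := by
  have hr : Set.range (AlgPoints.map (L := ℂ) j) = {Q : ComplexPoints X | Q.pt ∈ Set.range j.left.base} := by
    rw [AlgPoints.range_map_of_isOpenImmersion_holds]
    rfl
  exact ⟨(AlgPoints.isOpenEmbedding_map_holds (L := ℂ) j).isEmbedding.toHomeomorph.trans
    (Homeomorph.setCongr hr), fun P ↦ rfl⟩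

/-- `{Q | pt Q ∈ j(V)} ⊆ X(ℂ)` is open for an open immersion `j`. [cite: SerreGAGA1956, §2 n°5] -/
theorem isOpen_setOf_pt_mem_range {V : SchemeOver ℂ} (j : V ⟶ X) [IsOpenImmersion j.left] :
    IsOpen {Q : ComplexPoints X | Q.pt ∈ Set.range j.left.base} := by
  have h := AlgPoints.isOpen_setOf_pt_mem (X := X) (L := ℂ) j.left.opensRange
  convert h using 1
  ext Q
  change _ ↔ Q.pt ∈ (Scheme.Hom.opensRange j.left : Set X.left)
  rw [Scheme.Hom.coe_opensRange]
  rfl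

/-- **A Zariski-local product chart gives a topological trivialisation.** Given open immersions
`j : V ⟶ X`, `i : W ⟶ Y` with `π⁻¹(j(V)) ⊆ i(W)` and `e : W ≅ V × 𝔸ʳ` with `e ≫ pr₁ ≫ j = i ≫ π`, the
map `π(ℂ)` is, over the open subset `{Q | pt Q ∈ j(V)}` of `X(ℂ)`, homeomorphic over the base to the
projection `(–) × ℂʳ → (–)`. [cite: SerreGAGA1956, §2 n°5] -/
theorem exists_trivialisation_of_chart (π : Y ⟶ X) (r : ℕ) {V W : SchemeOver ℂ} (j : V ⟶ X)
    (i : W ⟶ Y) [IsOpenImmersion j.left] [IsOpenImmersion i.left]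
    (e : W ≅ V ⊗ affineSpaceOver (Fin r) ℂ)
    (hsub : π.left.base ⁻¹' Set.range j.left.base ⊆ Set.range i.left.base)
    (hsq : e.hom ≫ CartesianMonoidalCategory.fst _ _ ≫ j = i ≫ π) :
    ∃ φ : ↥((AlgPoints.mapContinuous (L := ℂ) π) ⁻¹'
        {Q : ComplexPoints X | Q.pt ∈ Set.range j.left.base}) ≃ₜ
        ↥{Q : ComplexPoints X | Q.pt ∈ Set.range j.left.base} × (Fin r → ℂ),
      ∀ x, ((φ x).1 : ComplexPoints X) = AlgPoints.mapContinuous (L := ℂ) π x := by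
  -- the preimage of the chart domain is the image of `i(ℂ)`
  have hpre : (AlgPoints.mapContinuous (L := ℂ) π) ⁻¹' {Q : ComplexPoints X | Q.pt ∈ Set.range j.left.base} =
      {Q' : ComplexPoints Y | Q'.pt ∈ Set.range i.left.base} := by
    ext Q'
    simp only [Set.mem_preimage, Set.mem_setOf_eq, AlgPoints.mapContinuous_apply, AlgPoints.pt_map]
    constructor
    · intro h
      exact hsub h
    · rintro ⟨w, hw⟩
      refine ⟨((e.hom ≫ CartesianMonoidalCategory.fst _ _).left.base w), ?_⟩
      rw [← hw]
      change ((e.hom ≫ CartesianMonoidalCategory.fst _ _).left ≫ j.left).base w = (i.left ≫ π.left).base w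
      rw [← Over.comp_left, ← Over.comp_left, Category.assoc, hsq]
  obtain ⟨θW', hθW'⟩ := exists_homeomorph_of_isOpenImmersion i
  let θW : ComplexPoints W ≃ₜ
      ↥((AlgPoints.mapContinuous (L := ℂ) π) ⁻¹' {Q : ComplexPoints X | Q.pt ∈ Set.range j.left.base}) :=
    θW'.trans (Homeomorph.setCongr hpre.symm)
  have hθW : ∀ Q, ((θW Q : ↥((AlgPoints.mapContinuous (L := ℂ) π) ⁻¹' _)) : ComplexPoints Y) =
      AlgPoints.map i Q := hθW'
  obtain ⟨θV, hθV⟩ := exists_homeomorph_of_isOpenImmersion j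
  -- points along the isomorphism and the product decomposition
  let θε : ComplexPoints W ≃ₜ ComplexPoints (V ⊗ affineSpaceOver (Fin r) ℂ) :=
    { toFun := AlgPoints.map e.hom
      invFun := AlgPoints.map e.inv
      left_inv := fun Q ↦ by
        change AlgPoints.map e.inv (AlgPoints.map e.hom Q) = Q
        rw [← AlgPoints.map_comp_apply, e.hom_inv_id, AlgPoints.map_id_apply]
      right_inv := fun Q ↦ by
        change AlgPoints.map e.hom (AlgPoints.map e.inv Q) = Q
        rw [← AlgPoints.map_comp_apply, e.inv_hom_id, AlgPoints.map_id_apply]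
      continuous_toFun := AlgPoints.continuous_map e.hom
      continuous_invFun := AlgPoints.continuous_map e.inv }
  let θP : ComplexPoints (V ⊗ affineSpaceOver (Fin r) ℂ) ≃ₜ
      ComplexPoints V × ComplexPoints (affineSpaceOver (Fin r) ℂ) :=
    { toEquiv := AlgPoints.prodEquiv
      continuous_toFun := AlgPoints.continuous_prodEquiv
      continuous_invFun := AlgPoints.continuous_prodEquiv_symm }
  let φ : ↥((AlgPoints.mapContinuous (L := ℂ) π) ⁻¹' {Q : ComplexPoints X | Q.pt ∈ Set.range j.left.base}) ≃ₜ
      ↥{Q : ComplexPoints X | Q.pt ∈ Set.range j.left.base} × (Fin r → ℂ) :=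
    θW.symm.trans (θε.trans (θP.trans (θV.prodCongr (ComplexPoints.affineHomeomorph r).symm)))
  refine ⟨φ, fun x ↦ ?_⟩
  obtain ⟨Q', rfl⟩ := θW.surjective x
  change ((θV (AlgPoints.prodEquiv (AlgPoints.map e.hom (θW.symm (θW Q')))).1 :
      ↥{Q : ComplexPoints X | Q.pt ∈ Set.range j.left.base}) : ComplexPoints X) =
    AlgPoints.map π ((θW Q').1)
  rw [θW.symm_apply_apply, AlgPoints.prodEquiv_apply_fst, hθV, hθW]
  rw [← AlgPoints.map_comp_apply, ← AlgPoints.map_comp_apply, ← AlgPoints.map_comp_apply, hsq]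

/-- **Affine-space bundles are cohomology isomorphisms.** If `π : Y ⟶ X` is Zariski-locally on `X` a
product with `𝔸ʳ` and `X(ℂ)` is paracompact Hausdorff (e.g. `X` projective), then
`π^* : Hᵏ(X(ℂ); ℂ) → Hᵏ(Y(ℂ); ℂ)` is bijective for every `k`: `π(ℂ)` is a locally trivial bundle with
the contractible fibre `ℂʳ` (`exists_trivialisation_of_chart`), and the Leray–Hirsch theorem with the
single class `1` applies (`bijective_map_of_trivial_contractible_fibre`; Dold 1963, Thm. 6.3).
[cite: HusemollerFibreBundles1994, Ch. 17 §1 Thm. 1.1] -/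
theorem bijective_complexBetti_map_of_isZariskiLocallyAffineProduct [T2Space (ComplexPoints X)]
    [ParacompactSpace (ComplexPoints X)] {π : Y ⟶ X} {r : ℕ}
    (hπ : IsZariskiLocallyAffineProduct π r) (k : ℕ) :
    Function.Bijective (complexBetti.map π k) := by
  classical
  choose V W j i hj hi e hx hsub hsq using hπ
  -- the open cover of `X(ℂ)` by the chart domains
  let U : X.left → Set (ComplexPoints X) := fun x ↦ {Q | Q.pt ∈ Set.range (j x).left.base}
  have hUo : ∀ x, IsOpen (U x) := fun x ↦ by
    haveI := hj x
    exact isOpen_setOf_pt_mem_range (j x)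
  have hU : ⋃ x, U x = univ := by
    refine Set.eq_univ_of_forall fun Q ↦ Set.mem_iUnion.mpr ⟨Q.pt, ?_⟩
    exact hx Q.pt
  -- the trivialisations over the chart domains
  have hφ : ∀ x, ∃ φ : ↥((AlgPoints.mapContinuous (L := ℂ) π) ⁻¹' U x) ≃ₜ ↥(U x) × (Fin r → ℂ),
      ∀ y, ((φ y).1 : ComplexPoints X) = AlgPoints.mapContinuous (L := ℂ) π y := fun x ↦ by
    haveI := hj x
    haveI := hi x
    exact exists_trivialisation_of_chart π r (j x) (i x) (e x) (hsub x) (hsq x)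
  choose φ hφ using hφ
  exact bijective_map_of_trivial_contractible_fibre ℂ (AlgPoints.mapContinuous (L := ℂ) π) U hUo hU
    φ hφ k

end Topology

end HodgeTheory

end Literature.AlgebraicGeometry.HodgeTheory

end
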